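import Literature.Analysis.FluidPDE.NSBoundedMildOseenDuhamel
import Literature.Analysis.FluidPDE.OseenKernelLp
import HarnessLib

/-!
# Uniqueness of bounded solutions of the Oseen integral equation

Analysis/FluidPDE proofs file on the discharge path of the named fact (P) `knss2009_smoothing`
(`NSBoundedMildOseen.lean`; Koch–Nadirashvili–Seregin–Šverák 2009, Prop. 4.1). The printed proof
of Prop. 4.1 constructs the local smooth solution by a fixed point and *identifies it with the
given bounded mild solution*; the identification is the uniqueness of bounded solutions of the
integral equation
`u(t) = U(t) - B^ν_s(u,u)(t)` (`B^ν_s = oseenDuhamel ν s`), which the source states for the linear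
Stokes problem ("The definition of mild solutions immediately implies their uniqueness", §3 p. 6)
and obtains for Navier–Stokes from the bilinear estimate (4.4)
`‖B(u,v)‖_{L^∞} ≤ C√T ‖u‖_{L^∞} ‖v‖_{L^∞}` (§4 p. 8: (4.3) "can be solved in `L^∞_{x,t}` for
sufficiently small `T` by a fixed point argument"; Giga–Inui–Matsui 1999 for `u₀ ∈ L^∞`).
Everything here is **proved**:

* `exists_lintegral_enorm_oseenKernel_sub_le`: the slice estimate for a *difference* of tensors,
  `∫ ‖K(σ,x-y)[a,b] - K(σ,x-y)[a',b']‖ dy ≤ C σ^{-1/2} · 2 M S` when `‖a'‖, ‖b‖ ≤ M` everywhere and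
  `‖a - a'‖, ‖b - b'‖ ≤ S` almost everywhere (Koch–Tataru's kernel bound (14) and bilinearity);
* `oseenMild_bounded_unique`: **two bounded, jointly measurable solutions `u`, `v` of the integral
  equation on `(s, T)` with the same free term agree a.e. at every time.** Proof (no Gronwall
  lemma is needed): if `u = v` a.e. on the slices `τ ≤ α` and `‖u(τ) - v(τ)‖_∞ ≤ S` for
  `α < τ ≤ β`, then for `α < t ≤ β`, a.e. in `x`,
  `‖u(t,x) - v(t,x)‖ = ‖B(u,u)(t,x) - B(v,v)(t,x)‖ ≤ ∫_α^t C(ν(t-τ))^{-1/2} 2MS dτ ≤ 4CMν^{-1/2}√(β-α) S`;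
  with blocks of length `η`, `4CMν^{-1/2}√η ≤ 1/2`, the bound halves at each iteration, so
  `u = v` a.e. on the block, and an induction over the blocks exhausts `(s, T)`;
* `oseenMild_essBounded_unique`: the same for fields with *essentially* bounded slices
  (`eLpNorm (u t) ∞ volume ≤ M`, the hypotheses of `knss2009_smoothing`), through bounded
  representatives (radial retraction, as in `BoundedRepresentative.lean`).

## Mathlib / tree search

Tree: `oseenDuhamel`, `oseenDuhamel_congr_ae_slice`, `integrable_oseenKernel_duhamel_bounded`
(`NSBoundedMildOseen*.lean`), `exists_norm_oseenKernel_le` (`KochTataruKernel.lean`),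
`lintegral_enorm_oseenEnvelope` (`OseenKernelLp.lean`), `setLIntegral_Ioo_sub_rpow_neg_half_of_lt`,
`volume_restrict_prod_univ_eq_prod`. Nothing on uniqueness for the kernel form of the equation
(`lean search 'oseenMild|oseenDuhamel.*unique'`). Mathlib: `Integrable.integral_prod_left`,
`Integrable.prod_right_ae`, `eLpNormEssSup_le_of_ae_enorm_bound`, `ae_le_eLpNormEssSup`,
`eLpNormEssSup_eq_zero_iff`.

## References

* G. Koch, N. Nadirashvili, G. Seregin, V. Šverák, *Liouville theorems for the Navier–Stokes
  equations and applications*, Acta Math. 203 (2009) 83–105 = arXiv:0709.3599, §3 p. 6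
  (uniqueness of mild solutions), §4 p. 8 ((4.3)–(4.4), the fixed point in `L^∞_{x,t}`).
  [KochNadirashviliSereginSverak2009]
* Y. Giga, K. Inui, S. Matsui, *On the Cauchy problem for the Navier–Stokes equations with
  nondecaying initial data*, Quaderni di Matematica 4 (1999) 27–68 (existence and uniqueness of
  local mild solutions for `u₀ ∈ L^∞`).
-/

noncomputable section

open MeasureTheory Set Function Filter TopologicalSpace InnerProductSpace Metric
open _root_.Topology
open scoped RealInnerProductSpace NNReal ENNReal

namespace Literature.Analysis.FluidPDE

variable {E : Type*} [NormedAddCommGroup E] [InnerProductSpace ℝ E] [FiniteDimensional ℝ E]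
  [MeasurableSpace E] [BorelSpace E]

/-! ### The slice estimate for a difference of tensors -/

section Slice

omit [FiniteDimensional ℝ E] [MeasurableSpace E] [BorelSpace E] in
/-- Bilinearity: `K[a,b] - K[a',b'] = K[a - a', b] + K[a', b - b']`. [folklore] -/
theorem oseenKernel_sub_oseenKernel (σ : ℝ) (z a a' b b' : E) :
    oseenKernel σ z a b - oseenKernel σ z a' b' =
      oseenKernel σ z (a - a') b + oseenKernel σ z a' (b - b') := by
  rw [oseenKernel_sub_left, oseenKernel_sub_right]
  abel

/-- **The slice estimate for a difference of tensors** (Koch–Tataru's bound (14) and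
bilinearity): there is `C = C(E) > 0` such that for `σ > 0`, fields `a, a', b, b'` with
`‖a'‖, ‖b‖ ≤ M` everywhere and `‖a - a'‖, ‖b - b'‖ ≤ S` almost everywhere, and every `x`,
`∫ ‖K(σ, x-y)[a(y), b(y)] - K(σ, x-y)[a'(y), b'(y)]‖ dy ≤ C σ^{-1/2} (2 M S)` (in `ℝ≥0∞`; no
measurability is needed). [cite: KochTataruAdvMath2001, §3 (14)] -/
theorem exists_lintegral_enorm_oseenKernel_sub_le :
    ∃ C : ℝ, 0 < C ∧ ∀ {σ : ℝ}, 0 < σ → ∀ {a a' b b' : E → E} {M S : ℝ}, 0 ≤ M → 0 ≤ S →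
      (∀ y, ‖a' y‖ ≤ M) → (∀ y, ‖b y‖ ≤ M) →
      (∀ᵐ y ∂(volume : Measure E), ‖a y - a' y‖ ≤ S) →
      (∀ᵐ y ∂(volume : Measure E), ‖b y - b' y‖ ≤ S) → ∀ x : E,
        ∫⁻ y, ‖oseenKernel σ (x - y) (a y) (b y) - oseenKernel σ (x - y) (a' y) (b' y)‖ₑ ≤
          ENNReal.ofReal (C * σ ^ (-(1 / 2 : ℝ)) * (2 * M * S)) := by
  set d : ℝ := (Module.finrank ℝ E : ℝ) with hd
  obtain ⟨C₀, hC₀, hK⟩ := exists_norm_oseenKernel_le (E := E)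
  set I : ℝ := ∫ w : E, (1 + ‖w‖ ^ 2) ^ (-((d + 1) / 2)) with hI
  have he : d < 2 * ((d + 1) / 2) := by linarith
  have hI0 : 0 < I := integral_one_add_norm_sq_rpow_neg_pos he
  refine ⟨C₀ * I, by positivity, fun {σ} hσ {a a' b b' M S} hM hS ha' hb hda hdb x => ?_⟩
  set Env : E → ℝ := fun z => C₀ * (σ + ‖z‖ ^ 2) ^ (-((d + 1) / 2)) with hEnv
  have hEnv0 : ∀ z, 0 ≤ Env z := fun z => mul_nonneg hC₀.le (Real.rpow_nonneg (by positivity) _)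
  -- pointwise domination, almost everywhere in `y`
  have hdom : ∀ᵐ y ∂(volume : Measure E),
      ‖oseenKernel σ (x - y) (a y) (b y) - oseenKernel σ (x - y) (a' y) (b' y)‖ₑ ≤
        ‖Env (x - y)‖ₑ * ENNReal.ofReal (2 * M * S) := by
    filter_upwards [hda, hdb] with y hya hyb
    rw [oseenKernel_sub_oseenKernel, ← ofReal_norm, Real.enorm_eq_ofReal (hEnv0 _),
      ← ENNReal.ofReal_mul (hEnv0 _)]
    refine ENNReal.ofReal_le_ofReal ?_
    calc ‖oseenKernel σ (x - y) (a y - a' y) (b y) + oseenKernel σ (x - y) (a' y) (b y - b' y)‖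
        ≤ ‖oseenKernel σ (x - y) (a y - a' y) (b y)‖ + ‖oseenKernel σ (x - y) (a' y) (b y - b' y)‖ :=
          norm_add_le _ _
      _ ≤ C₀ * (σ + ‖x - y‖ ^ 2) ^ (-((d + 1) / 2)) * ‖a y - a' y‖ * ‖b y‖ +
            C₀ * (σ + ‖x - y‖ ^ 2) ^ (-((d + 1) / 2)) * ‖a' y‖ * ‖b y - b' y‖ :=
          add_le_add (hK hσ _ _ _) (hK hσ _ _ _)
      _ ≤ C₀ * (σ + ‖x - y‖ ^ 2) ^ (-((d + 1) / 2)) * S * M +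
            C₀ * (σ + ‖x - y‖ ^ 2) ^ (-((d + 1) / 2)) * M * S := by
          have h0 : 0 ≤ C₀ * (σ + ‖x - y‖ ^ 2) ^ (-((d + 1) / 2)) := hEnv0 _
          gcongr
          · exact hb y
          · exact ha' y
      _ = Env (x - y) * (2 * M * S) := by rw [hEnv]; ring
  have hscal : d / 2 - (d + 1) / 2 = -(1 / 2 : ℝ) := by ring
  calc ∫⁻ y, ‖oseenKernel σ (x - y) (a y) (b y) - oseenKernel σ (x - y) (a' y) (b' y)‖ₑ
      ≤ ∫⁻ y, ‖Env (x - y)‖ₑ * ENNReal.ofReal (2 * M * S) := lintegral_mono_ae hdom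
    _ = (∫⁻ y, ‖Env (x - y)‖ₑ) * ENNReal.ofReal (2 * M * S) :=
        lintegral_mul_const' _ _ ENNReal.ofReal_ne_top
    _ = (∫⁻ z, ‖Env z‖ₑ) * ENNReal.ofReal (2 * M * S) := by
        rw [lintegral_sub_left_eq_self (fun z => ‖Env z‖ₑ) x]
    _ = ENNReal.ofReal (C₀ * (σ ^ (-(1 / 2 : ℝ)) * I)) * ENNReal.ofReal (2 * M * S) := by
        rw [hEnv, lintegral_enorm_oseenEnvelope hC₀.le hσ]
    _ = ENNReal.ofReal (C₀ * I * σ ^ (-(1 / 2 : ℝ)) * (2 * M * S)) := by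
        rw [← ENNReal.ofReal_mul (by positivity)]
        ring_nf

end Slice

/-! ### Uniqueness of bounded solutions of the integral equation -/

section Unique

variable {ν s T M : ℝ} {U u v : ℝ → E → E}

/-- **The key estimate.** Let `u`, `v` be bounded by `M` on `(s, T) × E`, jointly measurable,
and solve `u(t) = U(t) - B^ν_s(u,u)(t)`, `v(t) = U(t) - B^ν_s(v,v)(t)` a.e. for `t ∈ (s, T)`. If
`u(τ) = v(τ)` a.e. for `τ ≤ α` and `‖u(τ) - v(τ)‖_{L^∞} ≤ S` for `α < τ ≤ β`, then for
`α < t ≤ β` (`t < T`), `‖u(t) - v(t)‖_{L^∞} ≤ 4 C M ν^{-1/2} √(β - α) S` with the constant of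
`exists_lintegral_enorm_oseenKernel_sub_le` (KNSS 2009, (4.4)). [cite: KochNadirashviliSereginSverak2009, §4 (4.3)–(4.4) (arXiv:0709.3599 p. 8)] -/
theorem eLpNorm_sub_le_of_blocks {C : ℝ} (hC : 0 < C)
    (hCK : ∀ {σ : ℝ}, 0 < σ → ∀ {a a' b b' : E → E} {M S : ℝ}, 0 ≤ M → 0 ≤ S →
      (∀ y, ‖a' y‖ ≤ M) → (∀ y, ‖b y‖ ≤ M) →
      (∀ᵐ y ∂(volume : Measure E), ‖a y - a' y‖ ≤ S) →
      (∀ᵐ y ∂(volume : Measure E), ‖b y - b' y‖ ≤ S) → ∀ x : E,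
        ∫⁻ y, ‖oseenKernel σ (x - y) (a y) (b y) - oseenKernel σ (x - y) (a' y) (b' y)‖ₑ ≤
          ENNReal.ofReal (C * σ ^ (-(1 / 2 : ℝ)) * (2 * M * S)))
    (hν : 0 < ν) (hM : 0 ≤ M)
    (hum : AEStronglyMeasurable (uncurry u) ((volume : Measure (ℝ × E)).restrict (Ioo s T ×ˢ univ)))
    (hvm : AEStronglyMeasurable (uncurry v) ((volume : Measure (ℝ × E)).restrict (Ioo s T ×ˢ univ)))
    (huM : ∀ τ ∈ Ioo s T, ∀ y, ‖u τ y‖ ≤ M) (hvM : ∀ τ ∈ Ioo s T, ∀ y, ‖v τ y‖ ≤ M)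
    (hu : ∀ t ∈ Ioo s T, u t =ᵐ[volume] fun x => U t x - oseenDuhamel ν s u u t x)
    (hv : ∀ t ∈ Ioo s T, v t =ᵐ[volume] fun x => U t x - oseenDuhamel ν s v v t x)
    {α β S : ℝ} (hS : 0 ≤ S)
    (hα : ∀ τ ∈ Ioo s T, τ ≤ α → u τ =ᵐ[volume] v τ)
    (hβ : ∀ τ ∈ Ioo s T, α < τ → τ ≤ β → eLpNorm (u τ - v τ) ∞ volume ≤ ENNReal.ofReal S)
    {t : ℝ} (ht : t ∈ Ioo s T) (hαt : α < t) (htβ : t ≤ β) :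
    eLpNorm (u t - v t) ∞ volume ≤
      ENNReal.ofReal (4 * C * M * ν ^ (-(1 / 2 : ℝ)) * Real.sqrt (β - α) * S) := by
  have hst : s < t := ht.1
  -- the Duhamel integrands and their integrability on `(s, t) × E`
  have hIu : ∀ x : E, Integrable
      (fun p : ℝ × E => oseenKernel (ν * (t - p.1)) (x - p.2) (u p.1 p.2) (u p.1 p.2))
      ((volume.restrict (Ioo s t)).prod (volume : Measure E)) := fun x => by
    rw [← volume_restrict_prod_univ_eq_prod]
    exact integrable_oseenKernel_duhamel_bounded hν hum hum hM huM huM hst ht.2.le x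
  have hIv : ∀ x : E, Integrable
      (fun p : ℝ × E => oseenKernel (ν * (t - p.1)) (x - p.2) (v p.1 p.2) (v p.1 p.2))
      ((volume.restrict (Ioo s t)).prod (volume : Measure E)) := fun x => by
    rw [← volume_restrict_prod_univ_eq_prod]
    exact integrable_oseenKernel_duhamel_bounded hν hvm hvm hM hvM hvM hst ht.2.le x
  -- the bound on the difference of the Duhamel terms, at every `x`
  set K₁ : ℝ := C * ν ^ (-(1 / 2 : ℝ)) * (2 * M * S) with hK₁
  have hK₁0 : 0 ≤ K₁ := by positivity
  have hdiff : ∀ x : E, ‖oseenDuhamel ν s u u t x - oseenDuhamel ν s v v t x‖ₑ ≤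
      ENNReal.ofReal (4 * C * M * ν ^ (-(1 / 2 : ℝ)) * Real.sqrt (β - α) * S) := by
    intro x
    have hu1 := (hIu x).integral_prod_left
    have hv1 := (hIv x).integral_prod_left
    have hsub : oseenDuhamel ν s u u t x - oseenDuhamel ν s v v t x =
        ∫ τ in Ioo s t, ((∫ y, oseenKernel (ν * (t - τ)) (x - y) (u τ y) (u τ y)) -
          ∫ y, oseenKernel (ν * (t - τ)) (x - y) (v τ y) (v τ y)) := by
      rw [oseenDuhamel, oseenDuhamel, ← integral_sub hu1 hv1]
    -- a.e. in `τ`: slice integrability, and the pointwise bound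
    have hae_u := (hIu x).prod_right_ae
    have hae_v := (hIv x).prod_right_ae
    have hbound : ∀ᵐ τ ∂(volume.restrict (Ioo s t)),
        ‖(∫ y, oseenKernel (ν * (t - τ)) (x - y) (u τ y) (u τ y)) -
            ∫ y, oseenKernel (ν * (t - τ)) (x - y) (v τ y) (v τ y)‖ₑ ≤
          (Ioi α).indicator (fun τ => ENNReal.ofReal K₁ * ENNReal.ofReal ((t - τ) ^ (-(1 / 2 : ℝ)))) τ := by
      filter_upwards [hae_u, hae_v, ae_restrict_mem measurableSet_Ioo] with τ hτu hτv hτ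
      have hτT : τ ∈ Ioo s T := ⟨hτ.1, hτ.2.trans ht.2⟩
      by_cases hτα : τ ≤ α
      · -- before `α` the slices agree a.e.
        have heq : (∫ y, oseenKernel (ν * (t - τ)) (x - y) (u τ y) (u τ y)) =
            ∫ y, oseenKernel (ν * (t - τ)) (x - y) (v τ y) (v τ y) := by
          refine integral_congr_ae ?_
          filter_upwards [hα τ hτT hτα] with y hy
          rw [hy]
        rw [heq, sub_self, enorm_zero]
        exact zero_le
      · rw [not_le] at hτα
        rw [indicator_of_mem (mem_Ioi.2 hτα), ← integral_sub hτu hτv]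
        have hσ : 0 < ν * (t - τ) := mul_pos hν (sub_pos.2 hτ.2)
        have hτβ : τ ≤ β := hτ.2.le.trans htβ
        have hSτ : ∀ᵐ y ∂(volume : Measure E), ‖u τ y - v τ y‖ ≤ S := by
          have h1 : ∀ᵐ y ∂(volume : Measure E), ‖(u τ - v τ) y‖ₑ ≤ ENNReal.ofReal S :=
            (ae_le_eLpNormEssSup (f := u τ - v τ)).mono fun y hy =>
              hy.trans (by rw [← eLpNorm_exponent_top]; exact hβ τ hτT hτα hτβ)
          filter_upwards [h1] with y hy
          rw [Pi.sub_apply, ← ofReal_norm] at hy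
          exact (ENNReal.ofReal_le_ofReal_iff hS).1 hy
        calc ‖∫ y, (oseenKernel (ν * (t - τ)) (x - y) (u τ y) (u τ y) -
                oseenKernel (ν * (t - τ)) (x - y) (v τ y) (v τ y))‖ₑ
            ≤ ∫⁻ y, ‖oseenKernel (ν * (t - τ)) (x - y) (u τ y) (u τ y) -
                oseenKernel (ν * (t - τ)) (x - y) (v τ y) (v τ y)‖ₑ :=
              enorm_integral_le_lintegral_enorm _
          _ ≤ ENNReal.ofReal (C * (ν * (t - τ)) ^ (-(1 / 2 : ℝ)) * (2 * M * S)) :=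
              hCK hσ hM hS (hvM τ hτT) (huM τ hτT) hSτ hSτ x
          _ = ENNReal.ofReal K₁ * ENNReal.ofReal ((t - τ) ^ (-(1 / 2 : ℝ))) := by
              rw [← ENNReal.ofReal_mul hK₁0]
              congr 1
              rw [hK₁, Real.mul_rpow hν.le (sub_pos.2 hτ.2).le]
              ring
    calc ‖oseenDuhamel ν s u u t x - oseenDuhamel ν s v v t x‖ₑ
        = ‖∫ τ in Ioo s t, ((∫ y, oseenKernel (ν * (t - τ)) (x - y) (u τ y) (u τ y)) -
            ∫ y, oseenKernel (ν * (t - τ)) (x - y) (v τ y) (v τ y))‖ₑ := by rw [hsub]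
      _ ≤ ∫⁻ τ in Ioo s t, ‖(∫ y, oseenKernel (ν * (t - τ)) (x - y) (u τ y) (u τ y)) -
            ∫ y, oseenKernel (ν * (t - τ)) (x - y) (v τ y) (v τ y)‖ₑ :=
          enorm_integral_le_lintegral_enorm _
      _ ≤ ∫⁻ τ in Ioo s t, (Ioi α).indicator
            (fun τ => ENNReal.ofReal K₁ * ENNReal.ofReal ((t - τ) ^ (-(1 / 2 : ℝ)))) τ :=
          lintegral_mono_ae hbound
      _ = ∫⁻ τ in Ioo s t ∩ Ioi α, ENNReal.ofReal K₁ * ENNReal.ofReal ((t - τ) ^ (-(1 / 2 : ℝ))) := by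
          rw [lintegral_indicator measurableSet_Ioi, Measure.restrict_restrict measurableSet_Ioi,
            inter_comm]
      _ ≤ ∫⁻ τ in Ioo α t, ENNReal.ofReal K₁ * ENNReal.ofReal ((t - τ) ^ (-(1 / 2 : ℝ))) := by
          refine lintegral_mono_set fun τ hτ => ?_
          exact ⟨hτ.2, hτ.1.2⟩
      _ = ENNReal.ofReal K₁ * ENNReal.ofReal (2 * Real.sqrt (t - α)) := by
          rw [lintegral_const_mul' _ _ ENNReal.ofReal_ne_top,
            setLIntegral_Ioo_sub_rpow_neg_half_of_lt hαt]
      _ ≤ ENNReal.ofReal K₁ * ENNReal.ofReal (2 * Real.sqrt (β - α)) := by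
          gcongr
      _ = ENNReal.ofReal (4 * C * M * ν ^ (-(1 / 2 : ℝ)) * Real.sqrt (β - α) * S) := by
          rw [← ENNReal.ofReal_mul hK₁0, hK₁]
          ring_nf
  -- transfer to `u t - v t` through the integral equations
  rw [eLpNorm_exponent_top]
  refine eLpNormEssSup_le_of_ae_enorm_bound ?_
  filter_upwards [hu t ht, hv t ht] with x hux hvx
  rw [Pi.sub_apply, hux, hvx, sub_sub_sub_cancel_left, enorm_sub_rev]
  exact hdiff x

/-- **Uniqueness of bounded solutions of the Oseen integral equation** (KNSS 2009, §3 p. 6 and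
§4 p. 8; Giga–Inui–Matsui 1999): two jointly measurable fields `u`, `v`, bounded by `M` on
`(s, T) × E`, which both satisfy `w(t) = U(t) - B^ν_s(w,w)(t)` a.e. for every `t ∈ (s, T)` (the
same free term `U`, e.g. `e^{ν(t-s)Δ}a`), agree a.e. at every `t ∈ (s, T)`. Proof: induction over
time blocks of length `η` with `4CMν^{-1/2}√η ≤ 1/2`, inside each of which the key estimate
`eLpNorm_sub_le_of_blocks` halves the `L^∞` distance indefinitely. [cite: KochNadirashviliSereginSverak2009, §4 (4.3)–(4.4) (arXiv:0709.3599 p. 8)] -/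
theorem oseenMild_bounded_unique (hν : 0 < ν) (hM : 0 ≤ M)
    (hum : AEStronglyMeasurable (uncurry u) ((volume : Measure (ℝ × E)).restrict (Ioo s T ×ˢ univ)))
    (hvm : AEStronglyMeasurable (uncurry v) ((volume : Measure (ℝ × E)).restrict (Ioo s T ×ˢ univ)))
    (huM : ∀ τ ∈ Ioo s T, ∀ y, ‖u τ y‖ ≤ M) (hvM : ∀ τ ∈ Ioo s T, ∀ y, ‖v τ y‖ ≤ M)
    (hu : ∀ t ∈ Ioo s T, u t =ᵐ[volume] fun x => U t x - oseenDuhamel ν s u u t x)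
    (hv : ∀ t ∈ Ioo s T, v t =ᵐ[volume] fun x => U t x - oseenDuhamel ν s v v t x) :
    ∀ t ∈ Ioo s T, u t =ᵐ[volume] v t := by
  obtain ⟨C, hC, hCK⟩ := exists_lintegral_enorm_oseenKernel_sub_le (E := E)
  -- block length `η` with `4 C M ν^{-1/2} √η ≤ 1/2`
  set A : ℝ := 4 * C * M * ν ^ (-(1 / 2 : ℝ)) with hA
  have hA0 : 0 ≤ A := by positivity
  set η : ℝ := 1 / (4 * A ^ 2 + 1) with hη
  have hη0 : 0 < η := by positivity
  have hq : A * Real.sqrt η ≤ 1 / 2 := by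
    have h1 : A * Real.sqrt η = Real.sqrt (A ^ 2 * η) := by
      rw [Real.sqrt_mul (sq_nonneg A), Real.sqrt_sq hA0]
    rw [h1, Real.sqrt_le_left (by norm_num)]
    rw [hη, div_eq_mul_inv, ← mul_assoc, mul_inv_le_iff₀ (by positivity)]
    nlinarith [sq_nonneg A]
  -- the crude bound `‖u(τ) - v(τ)‖_∞ ≤ 2M`
  have hcrude : ∀ τ ∈ Ioo s T, eLpNorm (u τ - v τ) ∞ volume ≤ ENNReal.ofReal (2 * M) := by
    intro τ hτ
    rw [eLpNorm_exponent_top]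
    refine eLpNormEssSup_le_of_ae_enorm_bound (Eventually.of_forall fun y => ?_)
    rw [Pi.sub_apply, ← ofReal_norm]
    refine ENNReal.ofReal_le_ofReal ?_
    calc ‖u τ y - v τ y‖ ≤ ‖u τ y‖ + ‖v τ y‖ := norm_sub_le _ _
      _ ≤ M + M := add_le_add (huM τ hτ y) (hvM τ hτ y)
      _ = 2 * M := by ring
  -- one block: if `u = v` a.e. up to `α`, then also up to `α + η`
  have hblock : ∀ α : ℝ, (∀ τ ∈ Ioo s T, τ ≤ α → u τ =ᵐ[volume] v τ) →
      ∀ τ ∈ Ioo s T, τ ≤ α + η → u τ =ᵐ[volume] v τ := by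
    intro α hα
    -- the distance halves indefinitely on `(α, α + η]`
    have hiter : ∀ n : ℕ, ∀ τ ∈ Ioo s T, α < τ → τ ≤ α + η →
        eLpNorm (u τ - v τ) ∞ volume ≤ ENNReal.ofReal (2 * M / 2 ^ n) := by
      intro n
      induction n with
      | zero => intro τ hτ _ _; simpa using hcrude τ hτ
      | succ n ih =>
        intro τ hτ hατ hτη
        have hS : 0 ≤ 2 * M / 2 ^ n := by positivity
        have h := eLpNorm_sub_le_of_blocks hC hCK hν hM hum hvm huM hvM hu hv hS hα ih hτ hατ hτη
        refine h.trans (ENNReal.ofReal_le_ofReal ?_)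
        rw [add_sub_cancel_left]
        calc 4 * C * M * ν ^ (-(1 / 2 : ℝ)) * Real.sqrt η * (2 * M / 2 ^ n)
            = A * Real.sqrt η * (2 * M / 2 ^ n) := by rw [hA]
          _ ≤ 1 / 2 * (2 * M / 2 ^ n) := mul_le_mul_of_nonneg_right hq hS
          _ = 2 * M / 2 ^ (n + 1) := by rw [pow_succ]; ring
    intro τ hτ hτη
    by_cases hτα : τ ≤ α
    · exact hα τ hτ hτα
    rw [not_le] at hτα
    have hzero : eLpNorm (u τ - v τ) ∞ volume = 0 := by
      refine le_antisymm ?_ zero_le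
      have hlim : Tendsto (fun n : ℕ => ENNReal.ofReal (2 * M / 2 ^ n)) atTop (𝓝 0) := by
        rw [← ENNReal.ofReal_zero]
        refine ENNReal.tendsto_ofReal ?_
        have h := (tendsto_pow_atTop_nhds_zero_of_lt_one (by norm_num : (0 : ℝ) ≤ 1 / 2)
          (by norm_num : (1 / 2 : ℝ) < 1)).const_mul (2 * M)
        rw [mul_zero] at h
        refine h.congr fun n => ?_
        rw [one_div, inv_pow, div_eq_mul_inv]
      exact ge_of_tendsto' hlim fun n => hiter n τ hτ hτα hτη
    exact (eLpNormEssSup_eq_zero_iff.1 (by rwa [eLpNorm_exponent_top] at hzero)).mono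
      fun y hy => sub_eq_zero.1 hy
  -- induction over the blocks
  have hind : ∀ n : ℕ, ∀ τ ∈ Ioo s T, τ ≤ s + n * η → u τ =ᵐ[volume] v τ := by
    intro n
    induction n with
    | zero =>
      intro τ hτ hτs
      simp only [Nat.cast_zero, zero_mul, add_zero] at hτs
      exact absurd hτ.1 (not_lt.2 hτs)
    | succ n ih =>
      intro τ hτ hτs
      have h := hblock (s + n * η) ih τ hτ
      refine h ?_
      simpa [Nat.cast_succ, add_mul, one_mul, add_assoc] using hτs
  intro t ht
  obtain ⟨n, hn⟩ := exists_nat_ge ((t - s) / η)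
  refine hind n t ht ?_
  rw [div_le_iff₀ hη0] at hn
  linarith

/-- From an `L^∞` bound to an a.e. pointwise bound. [folklore] -/
theorem ae_norm_le_of_eLpNorm_top_le {f : E → E} {M : ℝ} (hM : 0 ≤ M)
    (hf : eLpNorm f ∞ volume ≤ ENNReal.ofReal M) : ∀ᵐ y ∂(volume : Measure E), ‖f y‖ ≤ M := by
  have h1 : ∀ᵐ y ∂(volume : Measure E), ‖f y‖ₑ ≤ ENNReal.ofReal M :=
    (ae_le_eLpNormEssSup (f := f)).mono fun y hy => hy.trans (by rwa [← eLpNorm_exponent_top])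
  filter_upwards [h1] with y hy
  rw [← ofReal_norm] at hy
  exact (ENNReal.ofReal_le_ofReal_iff hM).1 hy

/-- **Uniqueness for essentially bounded solutions** (the form matching the hypotheses of the
smoothing fact `knss2009_smoothing`): two jointly measurable fields with slices essentially
bounded by `M` on `(s, T)`, both satisfying `w(t) = U(t) - B^ν_s(w,w)(t)` a.e. for every
`t ∈ (s, T)`, agree a.e. at every time. Reduction to `oseenMild_bounded_unique` through the
bounded representatives `(M+1)/max(M+1, ‖w‖) • w` (the Duhamel term only sees a.e. classes of
slices, `oseenDuhamel_congr_ae_slice`). [cite: KochNadirashviliSereginSverak2009, §4 (4.3)–(4.4) (arXiv:0709.3599 p. 8)] -/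
theorem oseenMild_essBounded_unique (hν : 0 < ν) (hM : 0 ≤ M)
    (hum : AEStronglyMeasurable (uncurry u) ((volume : Measure (ℝ × E)).restrict (Ioo s T ×ˢ univ)))
    (hvm : AEStronglyMeasurable (uncurry v) ((volume : Measure (ℝ × E)).restrict (Ioo s T ×ˢ univ)))
    (huM : ∀ τ ∈ Ioo s T, eLpNorm (u τ) ∞ volume ≤ ENNReal.ofReal M)
    (hvM : ∀ τ ∈ Ioo s T, eLpNorm (v τ) ∞ volume ≤ ENNReal.ofReal M)
    (hu : ∀ t ∈ Ioo s T, u t =ᵐ[volume] fun x => U t x - oseenDuhamel ν s u u t x)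
    (hv : ∀ t ∈ Ioo s T, v t =ᵐ[volume] fun x => U t x - oseenDuhamel ν s v v t x) :
    ∀ t ∈ Ioo s T, u t =ᵐ[volume] v t := by
  -- bounded representatives of radius `M + 1`
  have hM1 : 0 < M + 1 := by linarith
  set ρ : E → E := fun w => ((M + 1) / max (M + 1) ‖w‖) • w with hρ
  have hρc : Continuous ρ := continuous_radialRetract hM1
  set u' : ℝ → E → E := fun τ y => ρ (u τ y) with hu'
  set v' : ℝ → E → E := fun τ y => ρ (v τ y) with hv'
  have hrep : ∀ {w : ℝ → E → E}, (∀ τ ∈ Ioo s T, eLpNorm (w τ) ∞ volume ≤ ENNReal.ofReal M) →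
      ∀ τ ∈ Ioo s T, (fun y => ρ (w τ y)) =ᵐ[volume] w τ := by
    intro w hw τ hτ
    filter_upwards [ae_norm_le_of_eLpNorm_top_le hM (hw τ hτ)] with y hy
    exact radialRetract_eq_self hM1 (by linarith)
  have hu'u : ∀ τ ∈ Ioo s T, u' τ =ᵐ[volume] u τ := hrep huM
  have hv'v : ∀ τ ∈ Ioo s T, v' τ =ᵐ[volume] v τ := hrep hvM
  have hu'm : AEStronglyMeasurable (uncurry u') ((volume : Measure (ℝ × E)).restrict (Ioo s T ×ˢ univ)) :=
    hρc.comp_aestronglyMeasurable hum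
  have hv'm : AEStronglyMeasurable (uncurry v') ((volume : Measure (ℝ × E)).restrict (Ioo s T ×ˢ univ)) :=
    hρc.comp_aestronglyMeasurable hvm
  have hu'M : ∀ τ ∈ Ioo s T, ∀ y, ‖u' τ y‖ ≤ M + 1 := fun τ _ y => norm_radialRetract_le hM1 _
  have hv'M : ∀ τ ∈ Ioo s T, ∀ y, ‖v' τ y‖ ≤ M + 1 := fun τ _ y => norm_radialRetract_le hM1 _
  -- the representatives solve the same integral equation
  have hsol : ∀ {w w' : ℝ → E → E}, (∀ τ ∈ Ioo s T, w' τ =ᵐ[volume] w τ) →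
      (∀ t ∈ Ioo s T, w t =ᵐ[volume] fun x => U t x - oseenDuhamel ν s w w t x) →
      ∀ t ∈ Ioo s T, w' t =ᵐ[volume] fun x => U t x - oseenDuhamel ν s w' w' t x := by
    intro w w' hw'w hw t ht
    have hB : ∀ x, oseenDuhamel ν s w w t x = oseenDuhamel ν s w' w' t x := fun x =>
      oseenDuhamel_congr_ae_slice (fun τ hτ => (hw'w τ ⟨hτ.1, hτ.2.trans ht.2⟩).symm)
        (fun τ hτ => (hw'w τ ⟨hτ.1, hτ.2.trans ht.2⟩).symm) x
    filter_upwards [hw'w t ht, hw t ht] with x hx hx'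
    rw [hx, hx', hB x]
  have key := oseenMild_bounded_unique hν hM1.le hu'm hv'm hu'M hv'M (hsol hu'u hu) (hsol hv'v hv)
  intro t ht
  exact ((hu'u t ht).symm.trans (key t ht)).trans (hv'v t ht)

end Unique

end Literature.Analysis.FluidPDE

end
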